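import Literature.AnabelianGeometry.SemiGraphs.TemperedPiTrees
import HarnessLib

/-!
# The transition morphisms `𝔾̃_j → 𝔾̃_i`, `𝔾_{S j} → 𝔾_{S i}` (`i ≤ j`) of a Galois tower ([SemiAnbd] §3 p. 41)

Mochizuki, *Semi-graphs of anabelioids*, Publ. RIMS **42** (2006), §3, proof of Thm. 3.7 (iii), p. 41
[cite: MochizukiSemiAnbd2006, Thm 3.7(iii) p.41]: "for `i ≥ j` we have natural maps `V_i → V_j`,
`E_i → E_j`" — the compatible system of trees `𝒢_{∞,i}` and finite levels `𝔾_j` along which compatible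
systems of fixed vertices / edges / subjoints are taken.

Sequel to `TemperedPiTrees.lean` (one step `n+1 → n`): for Galois level data `D` the transition
morphisms for all `i ≤ j`, by composing steps (`Nat.leRec`, as abc-iut-L3-t9's `GaloisLevelData.mapLE`),
with the shapes of the fields of `VerticialLevelData`/`FiniteLevelData` (`TemperedLevelData.lean`):
`treeTrans` with `treeTrans_self` (`trans_id`), `treeTrans_comp` (`trans_comp`), `treeTrans_over`
(`trans_over`), `treeTrans_act` (`trans_act`); `levelTrans` with `_self`/`_comp`/`levelTrans_act`
(`levelTrans_id/comp/act`), `levelTrans_proj` (`levelProj_trans`) and `treeTrans_quot` (`trans_quot`).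
Seat abc-iut-L3-t6 (row «P-TREE»). Nothing here bears on [IUTchIII] Cor. 3.12.
-/

namespace Literature.AnabelianGeometry.SemiGraphs

namespace ProfiniteSemiGraph

namespace GaloisLevelData

open CategoryTheory

universe u

variable {𝒢 : ProfiniteSemiGraph.{u}} (D : GaloisLevelData 𝒢) (h𝒢 : 𝒢.IsCountable)

/-! ### Trees -/

/-- **The transition morphism of trees `𝔾̃_j → 𝔾̃_i` for `i ≤ j`** (composite of the steps).
[cite: MochizukiSemiAnbd2006, Thm 3.7(iii) p.41] -/
noncomputable def treeTrans {i j : ℕ} (h : i ≤ j) : D.tree j ⟶ D.tree i :=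
  Nat.leRec (motive := fun j _ => D.tree j ⟶ D.tree i) (𝟙 _) (fun k _ φ => D.treeStep k ≫ φ) h

/-- `treeTrans (le_refl) = 𝟙` (the `trans_id` field). [cite: MochizukiSemiAnbd2006, Thm 3.7(iii) p.41] -/
theorem treeTrans_self (i : ℕ) : D.treeTrans (le_refl i) = 𝟙 _ :=
  Nat.leRec_self _ _

/-- `treeTrans (i ≤ k+1) = treeStep k ≫ treeTrans (i ≤ k)`. [cite: MochizukiSemiAnbd2006, Thm 3.7(iii) p.41] -/
theorem treeTrans_succ {i k : ℕ} (h : i ≤ k) (h' : i ≤ k + 1) :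
    D.treeTrans h' = D.treeStep k ≫ D.treeTrans h :=
  Nat.leRec_succ _ _ h

/-- Functoriality of the transitions of trees (the `trans_comp` field).
[cite: MochizukiSemiAnbd2006, Thm 3.7(iii) p.41] -/
theorem treeTrans_comp {i j k : ℕ} (hij : i ≤ j) (hjk : j ≤ k) :
    D.treeTrans hjk ≫ D.treeTrans hij = D.treeTrans (hij.trans hjk) := by
  induction k, hjk using Nat.le_induction with
  | base => rw [treeTrans_self, Category.id_comp]
  | succ k hjk ih =>
    rw [D.treeTrans_succ hjk, D.treeTrans_succ (hij.trans hjk), Category.assoc, ih]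

/-- The transitions of trees lie over `𝔾` (the `trans_over` field). [cite: MochizukiSemiAnbd2006, Thm 3.7(iii) p.41] -/
theorem treeTrans_over {i j : ℕ} (h : i ≤ j) : D.treeTrans h ≫ D.treeProj i = D.treeProj j := by
  induction j, h using Nat.le_induction with
  | base => rw [treeTrans_self, Category.id_comp]
  | succ k h ih => rw [D.treeTrans_succ h, Category.assoc, ih, D.treeStep_over]

/-- **The transitions of trees are `π₁^temp`-equivariant** (the `trans_act` field).
[cite: MochizukiSemiAnbd2006, Thm 3.7(iii) p.41] -/
theorem treeTrans_act {i j : ℕ} (h : i ≤ j) (g : D.temperedPi h𝒢) :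
    (D.treeAct h𝒢 j g).hom ≫ D.treeTrans h = D.treeTrans h ≫ (D.treeAct h𝒢 i g).hom := by
  induction j, h using Nat.le_induction with
  | base => rw [treeTrans_self, Category.id_comp, Category.comp_id]
  | succ k h ih =>
    rw [D.treeTrans_succ h, ← Category.assoc, D.treeStep_act h𝒢 k g, Category.assoc, ih,
      Category.assoc]

/-! ### Finite levels -/

/-- **The transition morphism `𝔾_{S j} → 𝔾_{S i}` of the finite levels for `i ≤ j`** (composite of the
`𝔾_{S (k+1)} → 𝔾_{S k}` induced by `D.g k`). [cite: MochizukiSemiAnbd2006, Thm 3.7(iii) p.41] -/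
noncomputable def levelTrans {i j : ℕ} (h : i ≤ j) : (D.S j).orbitGraph ⟶ (D.S i).orbitGraph :=
  Nat.leRec (motive := fun j _ => (D.S j).orbitGraph ⟶ (D.S i).orbitGraph) (𝟙 _)
    (fun k _ φ => CovObj.orbitGraphMap (D.g k) ≫ φ) h

/-- `levelTrans (le_refl) = 𝟙` (the `levelTrans_id` field). [cite: MochizukiSemiAnbd2006, Thm 3.7(iii) p.41] -/
theorem levelTrans_self (i : ℕ) : D.levelTrans (le_refl i) = 𝟙 _ :=
  Nat.leRec_self _ _

/-- `levelTrans (i ≤ k+1) = 𝔾(g k) ≫ levelTrans (i ≤ k)`. [cite: MochizukiSemiAnbd2006, Thm 3.7(iii) p.41] -/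
theorem levelTrans_succ {i k : ℕ} (h : i ≤ k) (h' : i ≤ k + 1) :
    D.levelTrans h' = CovObj.orbitGraphMap (D.g k) ≫ D.levelTrans h :=
  Nat.leRec_succ _ _ h

/-- Functoriality of the transitions of the levels (the `levelTrans_comp` field).
[cite: MochizukiSemiAnbd2006, Thm 3.7(iii) p.41] -/
theorem levelTrans_comp {i j k : ℕ} (hij : i ≤ j) (hjk : j ≤ k) :
    D.levelTrans hjk ≫ D.levelTrans hij = D.levelTrans (hij.trans hjk) := by
  induction k, hjk using Nat.le_induction with
  | base => rw [levelTrans_self, Category.id_comp]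
  | succ k hjk ih =>
    rw [D.levelTrans_succ hjk, D.levelTrans_succ (hij.trans hjk), Category.assoc, ih]

/-- The transitions of the levels lie over `𝔾` (the `levelProj_trans` field).
[cite: MochizukiSemiAnbd2006, Thm 3.7(iii) p.41] -/
theorem levelTrans_proj {i j : ℕ} (h : i ≤ j) :
    D.levelTrans h ≫ (D.S i).orbitGraphProj = (D.S j).orbitGraphProj := by
  induction j, h using Nat.le_induction with
  | base => rw [levelTrans_self, Category.id_comp]
  | succ k h ih => rw [D.levelTrans_succ h, Category.assoc, ih, CovObj.orbitGraphMap_comp_proj]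

/-- **The transitions of trees cover those of the levels** (the `trans_quot` field).
[cite: MochizukiSemiAnbd2006, Thm 3.7(iii) p.41] -/
theorem treeTrans_quot {i j : ℕ} (h : i ≤ j) :
    D.treeTrans h ≫ D.treeQuot i = D.treeQuot j ≫ D.levelTrans h := by
  induction j, h using Nat.le_induction with
  | base => rw [treeTrans_self, levelTrans_self, Category.id_comp, Category.comp_id]
  | succ k h ih =>
    rw [D.treeTrans_succ h, D.levelTrans_succ h, Category.assoc, ih, ← Category.assoc,
      D.treeStep_quot k, Category.assoc]

variable (hconn : ∀ (n : ℕ) (p q : (D.S n).Point), (D.S n).SameComponent p q)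

/-- **The transitions of the levels are `π₁^temp`-equivariant** (the `levelTrans_act` field), for
connected levels. [cite: MochizukiSemiAnbd2006, Thm 3.7(iii) p.41] -/
theorem levelTrans_act {i j : ℕ} (h : i ≤ j) (g : D.temperedPi h𝒢) :
    (D.levelAct h𝒢 hconn j g).hom ≫ D.levelTrans h = D.levelTrans h ≫ (D.levelAct h𝒢 hconn i g).hom := by
  induction j, h using Nat.le_induction with
  | base => rw [levelTrans_self, Category.id_comp, Category.comp_id]
  | succ k h ih =>
    rw [D.levelTrans_succ h, ← Category.assoc, D.levelStep_act h𝒢 hconn k g, Category.assoc, ih,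
      Category.assoc]

end GaloisLevelData

end ProfiniteSemiGraph

end Literature.AnabelianGeometry.SemiGraphs
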